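import Summits.Ventures.QEC.Census.CertTwoBlockShiftWindow
import Summits.Ventures.QEC.Census.CertBZPlaneSeg3
import Summits.Ventures.QEC.Census.Kernel.A1p_n150_k4_1cbad1bd.Cert
import HarnessLib

/-!
# `A1p_n150_k4_1cbad1bd` (census row `A1p_n150_k4_1cbad1bd`, `[[150, 4, 16]]`) — two-block shift lane families, file 15 of 15 (1 theorems: pseg3B_3_63_1; 3053210 lanes; KERNEL)

Source certificate `cert/search-3-a1plus/A1p_n150_k4_1cbad1bd.certA.json` (kernel A, `bz_aut` on the `Z` side; sha256 `8dcc27bbda4975e275ce8db73b95d414dda801a80143c4c5ec2317a751a0213f`, `certA=8dcc27bbda4975e2`;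
matrix_sha256 `1cbad1bdfe6a7c1197095288e159c245eda77eb25dc1473e50359981ee894a69`). Only `H^X`, `H^Z`, the allow-list, the upper witnesses and the rank certificates of the certificate are
used — the lower bound is RE-DERIVED by qec-type-01's TWO-BLOCK SHIFT lane (`Census/CertTwoBlockShift[Sound].lean`, PARTITION item 133): blocks
`[0,75)` / `[75,150)` of `ℤ_1×ℤ_75`, pigeonhole `|c ∩ B₁| ≤ 7 ∨ |c ∩ B₂| ≤ 7` (`wmax = 15`), transport by the block translations (qec-type-12
`AutGen` words) to a forced free column, RREF kernel basis with pivots in the heavy block (qec-search-7 `InfoSetCert`), one forced-top-row lane family per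
coset word of the heavy block's free columns (half A: 4 coset words × 83278001 lanes; half B: 4 × 83278001); `X` side by
qec-type-10's `X ↔ Z` swap (`xzSwapOK`); closer `DistCert.isCode_of_onesided_lower`. Tier KERNEL-std = CERTIFIED: every check `decide +kernel` or a proof
term, axioms ⊆ {propext, Classical.choice, Quot.sound}, NO `native_decide`. HONEST FRAMING: the certificate is DATA transcribed here and RE-CHECKED by the
kernel; nothing printed is used; census row `A1p_n150_k4_1cbad1bd` (cell A.1+; TABLE v148 code_id A1p_n150_k4_1cbad1bd: tier COMPUTED (certA 8dcc27bbda4975e2 = this certificate ∧ certB 63e3977c9e7487fe, signed:qec-ref-1) before this file).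
Census KERNEL-UPGRADE lane (director-qec R33); emitted by `emit_shift_row.py` (qec-type-01 g5; seg3 third-row split qec-type-01 g6) — do not edit by hand, re-emit.
-/

set_option autoImplicit false
set_option Elab.async false
set_option maxRecDepth 200000

namespace Summit.Ventures.QEC.Census.A1p_n150_k4_1cbad1bd

open Matrix Literature.InformationTheory.QuantumCodes Summit.Ventures.QEC.Census

set_option maxHeartbeats 400000000 in
/-- Half `B`, coset word 4: second row `63` (doubled), third rows `[57, 63)` (3053210 lanes; `decide +kernel`). -/
theorem pseg3B_3_63_1 : Plane.seg3OK A1p_n150_k4_1cbad1bd.cert.n (A1p_n150_k4_1cbad1bd.cert.dZ - 1) (A1p_n150_k4_1cbad1bd.cert.sideZ.found.map Prod.fst) ((A1p_n150_k4_1cbad1bd.shiftZ.B.lightRowsW A1p_n150_k4_1cbad1bd.shiftZ.wB A1p_n150_k4_1cbad1bd.cert.n) ++ [(A1p_n150_k4_1cbad1bd.shiftZ.B.topRow 32381941596820424322486)]) ((A1p_n150_k4_1cbad1bd.shiftZ.t - 1) + 1) (A1p_n150_k4_1cbad1bd.shiftZ.B.lightRowsW A1p_n150_k4_1cbad1bd.shiftZ.wB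 A1p_n150_k4_1cbad1bd.cert.n).length 63 57 6 353 = true := by
  decide +kernel

end Summit.Ventures.QEC.Census.A1p_n150_k4_1cbad1bd
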